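/-
Copyright (c) 2026. All rights reserved.
Released under Apache 2.0 license as described in the file LICENSE.
Authors: abc-iut cell, seat abc-iut-w5-d004 (SUBDAG FrdI:Prop4.4(iv); the birationalization
`C^birat` and its API are abc-iut-L6-t8's, the `BiratData` instance abc-iut-L6-t6's).
-/
import Literature.AlgebraicGeometry.Frobenioids.BirationalizationProp44
import Literature.AlgebraicGeometry.Frobenioids.BirationalizationMorphisms
import Literature.AlgebraicGeometry.Frobenioids.BirationalizationIsos
import Literature.AlgebraicGeometry.Frobenioids.EquivalenceUnitsTransport
import HarnessLib

/-!
# Frobenioids I, Proposition 4.4 (iv) for EVERY Frobenioid: co-angularity and isotropy transport into `C^birat`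

Mochizuki, *The geometry of Frobenioids I: the general theory*, Kyushu J. Math. **62** (2008)
293–400, §4, Proposition 4.4 (iv), statement kurims p. 83, PROOF p. 84 l. 30 – p. 85 l. 31
[cite: MochizukiFrdI2008, Prop. 4.4 (iv) p.83]: "A morphism of `C` maps to a(n) co-angular morphism
(respectively, isomorphism; morphism of Frobenius type; pull-back morphism; morphism of a given
Frobenius degree; isometry; pre-step; base-isomorphism) of `C^birat` if and only if it is a(n)
co-angular morphism (respectively, co-angular pre-step; co-angular base-isomorphism; co-angular linear
morphism; morphism of a given Frobenius degree; arbitrary morphism; pre-step; base-isomorphism) of `C`.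
… An object of `C` maps to an isotropic object of `C^birat` if and only if it is an isotropic object
of `C`."

PROOF-ONLY file (abc-iut cell, SUB-DAG `FrdI:Prop4.4(iv)`, director queue (1) / dag SUBDAG-WANTED v0;
seat abc-iut-w5-d004). It proves the image direction of (iv) — abc-iut-L1-t3's interface predicate
`PreFrobenioidData.Prop44iv` at abc-iut-L6-t6's datum `PreFrobenioid.biratData hF hsq` — for EVERY
Frobenioid, i.e. WITHOUT the isotropy hypothesis under which the instance-level discharge (L1 row M14)
closes, following the printed proof:
* `IsPreStep.isCoAngularPreStep_of_factor` (P44iv-L02): a pre-step `b` occurring as the middle factor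
  of a co-angular composite `c ≫ b ≫ d` (`d` linear, `c` or `d` a base-isomorphism) is a co-angular
  pre-step — "by applying the factorization of Definition 1.3, (v), (b), to `C′ → D′`" (p. 85 l. 5–7);
* `Birat.exists_factorisation_of_comp₃` (P44iv-L01): a factorisation `A^birat → C^birat → D^birat →
  B^birat` of `φ^birat` in `C^birat` "arises [cf. the proof of (i)] from a factorization
  `A′ → C′ → D′ → B` in `C`" after refining by a co-angular pre-step `A′ → A` (p. 85 l. 1–4; the
  squares of Prop. 1.11 (vii) = abc-iut-L6-t8's `HasBiratSquares`, discharged for every Frobenioid);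
* `Birat.isCoAngular_toBirat_map` (P44iv-L03): `φ` co-angular ⇒ `φ^birat` co-angular (p. 85 l. 4–8);
* `isIsotropic_of_isCoAngularPreStep` (P44iv-L07): the domain of a co-angular pre-step into an
  isotropic object is isotropic (isotropic hull, Def. 1.3 (vii)(a); the printed reference is
  Prop. 1.9 (iv)); `Birat.isIsotropic_toBirat_obj` (P44iv-L08): `A` isotropic ⇒ `A^birat` isotropic
  (Prop. 1.4 (i) = `isCoAngular_of_isIsotropic_codomains`, Def. 1.3 (vii)(b));
* `prop44iv_biratData_general` / `prop44iv_holds_of_isFrobenioid`: **[FrdI] Prop. 4.4 (iv) as typed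
  (`Prop44iv`) HOLDS for the birationalization of EVERY Frobenioid.**
The converse ("only if") directions of print are not part of the typed predicate and are not
addressed here. No new definition; nothing here bears on the disputed IUT claims.
-/

namespace Literature.AlgebraicGeometry.Frobenioids

open CategoryTheory Opposite

namespace PreFrobenioid

universe w v v' u u'

variable {D : Type u} [Category.{v} D] {Φ : Dᵒᵖ ⥤ CommMonCat.{w}}
  {C : Type u'} [Category.{v'} C] {F : C ⥤ ElemFrobenioid Φ}

/-! ### P44iv-L02: the middle pre-step of a co-angular composite is co-angular -/

/-- **P44iv-L02** ("by applying the factorization of Definition 1.3, (v), (b), to `C′ → D′`, we conclude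
that `C′ → D′` is a co-angular pre-step", FrdI p. 85 l. 5–7): if `c ≫ b ≫ d` is co-angular with `b` a
pre-step, `d` linear and `d` or `c` a base-isomorphism, then `b` is a co-angular pre-step. Indeed
`b = β ≫ α` with `β` a co-angular pre-step and `α` an isometric pre-step (Def. 1.3 (v)(b)), and the
co-angularity of `(c ≫ β) ≫ α ≫ d` (Def. 1.2 (iii)) forces `α` to be an isomorphism.
[cite: MochizukiFrdI2008, Prop. 4.4 (iv) p.85] -/
theorem IsPreStep.isCoAngularPreStep_of_factor (hF : IsFrobenioid F) {W X Y Z : C} {c : W ⟶ X}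
    {b : X ⟶ Y} {d : Y ⟶ Z} (hb : IsPreStep F b) (hd : IsLinear F d)
    (hbase : IsBaseIso F d ∨ IsBaseIso F c) (hco : IsCoAngular F (c ≫ b ≫ d)) :
    IsCoAngularPreStep F b := by
  obtain ⟨X', β, α, hβα, hβ, hα⟩ := hF.v_b_exists b hb
  have hiso : IsIso α := by
    refine hco (c ≫ β) α d ?_ hd hα.1 hα.2 ?_
    · rw [← hβα, Category.assoc, Category.assoc]
    · refine hbase.imp id fun hc => ?_
      change IsIso (Base F (c ≫ β))
      rw [base_comp]
      haveI : IsIso (Base F c) := hc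
      haveI : IsIso (Base F β) := hβ.2.2
      infer_instance
  rw [← hβα]
  haveI := hiso
  exact hβ.comp hF ⟨isCoAngular_of_isIso F hF.isPreFrobenioid.isTotallyEpimorphic α,
    isPreStep_of_isIso F α⟩

/-! ### P44iv-L07: co-angular pre-steps into isotropic objects have isotropic domain -/

/-- **P44iv-L07** (the input "Prop. 1.9 (iv)" of the printed proof, p. 85 l. 30, proved here from
Def. 1.3 (vii)): if `a : A′ → A` is a co-angular pre-step and `A` is isotropic then `A′` is isotropic.
The isotropic hull `h : A′ → H` (Def. 1.3 (vii)(a)) factors `a = h ≫ b` with `b` linear; co-angularity of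
`a = 𝟙 ≫ h ≫ b` makes the isometric pre-step `h` an isomorphism, and isotropy propagates along
`h⁻¹ : H → A′` (Def. 1.3 (vii)(b)). [cite: MochizukiFrdI2008, Prop. 4.4 (iv) p.85] -/
theorem isIsotropic_of_isCoAngularPreStep (hF : IsFrobenioid F) {A' A : C} {a : A' ⟶ A}
    (ha : IsCoAngularPreStep F a) (hA : IsIsotropic F A) : IsIsotropic F A' := by
  obtain ⟨H, h, hiso, hpre, hH, huniv⟩ := hF.vii_a A'
  obtain ⟨b, hb, -⟩ := huniv a hA
  have hdeg : IsLinear F b := by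
    have h1 := congrArg (degFr F) hb
    rw [degFr_comp, hpre.1, one_mul] at h1
    change degFr F b = 1
    rw [h1]
    exact ha.2.1
  haveI : IsIso h := by
    refine ha.1 (𝟙 A') h b ?_ hdeg hiso hpre (Or.inr ?_)
    · rw [Category.id_comp, hb]
    · exact (isPreStep_id' F A').2
  exact hF.vii_b (inv h) hH

/-! ### Pre-steps of `C^birat` with co-angular numerator are isomorphisms -/

namespace Birat

variable {hF : IsFrobenioid F} {hsq : HasBiratSquares F}

/-- A morphism `[(α, φ′)] : X ⇢ Y` of `C^birat` which is a PRE-STEP for `C^birat → F_{0_D}` (linear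
base-isomorphism) has `φ′` a pre-step of `C` (`deg_Fr φ′ = 1`, `Base φ′ = Base α ≫ Base[(α, φ′)]`
invertible). [cite: MochizukiFrdI2008, Prop. 4.4 (iv) p.84] -/
theorem isPreStep_num_of_isPreStep_homMk {X Y : Birat F hF hsq} (f : BiratFrac F X.out Y.out)
    (hg : (biratOps hF hsq).IsPreStep (Birat.homMk f)) : IsPreStep F f.num := by
  obtain ⟨hlin, hbase⟩ := hg
  haveI : IsIso (Base F f.den) := f.den_mem.2.2
  haveI hbase' : IsIso (inv (Base F f.den) ≫ Base F f.num) := hbase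
  exact ⟨hlin, IsIso.of_isIso_comp_left (inv (Base F f.den)) (Base F f.num)⟩

/-- A pre-step `[(α, φ′)]` of `C^birat` whose numerator `φ′` is CO-ANGULAR is an isomorphism:
`[(α, φ′)] = (α^birat)⁻¹ ≫ φ′^birat` with both factors images of co-angular pre-steps
(abc-iut-L6-t8's `isIso_toBirat_map`). [cite: MochizukiFrdI2008, Prop. 4.4 (iv) p.84] -/
theorem isIso_homMk_of_isPreStep_of_isCoAngular {X Y : Birat F hF hsq} (f : BiratFrac F X.out Y.out)
    (hg : (biratOps hF hsq).IsPreStep (Birat.homMk f)) (hco : IsCoAngular F f.num) :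
    @IsIso (Birat F hF hsq) _ X Y (Birat.homMk f) := by
  have hnum : IsCoAngularPreStep F f.num := ⟨hco, isPreStep_num_of_isPreStep_homMk f hg⟩
  haveI := isIso_toBirat_map (hF := hF) (hsq := hsq) f.den f.den_mem
  haveI := isIso_toBirat_map (hF := hF) (hsq := hsq) f.num hnum
  haveI : IsIso ((toBirat F hF hsq).map f.den ≫
      (Birat.homMk f : (toBirat F hF hsq).obj X.out ⟶ (toBirat F hF hsq).obj Y.out)) := by
    rw [toBirat_map_den_comp_homMk hF hsq f]; infer_instance
  exact IsIso.of_isIso_comp_left ((toBirat F hF hsq).map f.den)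
    (Birat.homMk f : (toBirat F hF hsq).obj X.out ⟶ (toBirat F hF hsq).obj Y.out)

/-! ### P44iv-L08: isotropic objects -/

/-- **P44iv-L08** (FrdI p. 85 l. 29–31): `A` isotropic in `C` ⇒ `A^birat` isotropic in `C^birat`. An
(isometric) pre-step `[(α, φ′)] : A^birat → Y` has `α : A′ → A` a co-angular pre-step, so `A′` is
isotropic (P44iv-L07), so every arrow out of `A′` is co-angular (Prop. 1.4 (i) with Def. 1.3
(vii)(b)), in particular the pre-step `φ′`; hence `[(α, φ′)]` is an isomorphism.
[cite: MochizukiFrdI2008, Prop. 4.4 (iv) p.85] -/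
theorem isIsotropic_toBirat_obj {A : C} (hA : IsIsotropic F A) :
    (biratOps hF hsq).IsIsotropic ((toBirat F hF hsq).obj A) := by
  intro Y g hg
  obtain ⟨f, rfl⟩ := Birat.homMk_surjective g
  have hsrc : IsIsotropic F f.src := isIsotropic_of_isCoAngularPreStep hF f.den_mem hA
  exact isIso_homMk_of_isPreStep_of_isCoAngular f hg.1
    (isCoAngular_of_isIsotropic_codomains F f.num fun X ψ => hF.vii_b ψ hsrc)


/-! ### P44iv-L01/L03: co-angular morphisms -/

/-- The right leg `φ″` of a composition square `α′ ≫ φ′ = φ″ ≫ β` (Prop. 1.11 (vii)) over a PRE-STEP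
`φ′` is a pre-step (degrees and base-isomorphisms cancel against the co-angular pre-steps `α′`, `β`).
[cite: MochizukiFrdI2008, Prop. 4.4 (i) p.84] -/
theorem isPreStep_right_of_square {A B B' : C} {f : BiratFrac F A B} {g : BiratFrac F B B'}
    (S : BiratFrac.Square f g) (hf : IsPreStep F f.num) : IsPreStep F S.right := by
  have hw := S.w
  refine ⟨?_, ?_⟩
  · have hdeg := congrArg (degFr F) hw
    rw [degFr_comp, degFr_comp, S.left_mem.2.1, hf.1, g.den_mem.2.1, mul_one, mul_one] at hdeg
    exact hdeg.symm
  · have hb := congrArg (Base F) hw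
    rw [base_comp, base_comp] at hb
    haveI : IsIso (Base F S.left) := S.left_mem.2.2
    haveI : IsIso (Base F f.num) := hf.2
    haveI : IsIso (Base F g.den) := g.den_mem.2.2
    haveI : IsIso (Base F S.right ≫ Base F g.den) := by rw [← hb]; infer_instance
    exact IsIso.of_isIso_comp_right (Base F S.right) (Base F g.den)

/-- The right leg of a composition square over a morphism `φ′` with `Base φ′` invertible has invertible
base map. [cite: MochizukiFrdI2008, Prop. 4.4 (i) p.84] -/
theorem isBaseIso_right_of_square {A B B' : C} {f : BiratFrac F A B} {g : BiratFrac F B B'}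
    (S : BiratFrac.Square f g) (hf : IsBaseIso F f.num) : IsBaseIso F S.right := by
  have hb := congrArg (Base F) S.w
  rw [base_comp, base_comp] at hb
  haveI : IsIso (Base F S.left) := S.left_mem.2.2
  haveI : IsIso (Base F f.num) := hf
  haveI : IsIso (Base F g.den) := g.den_mem.2.2
  haveI : IsIso (Base F S.right ≫ Base F g.den) := by rw [← hb]; infer_instance
  exact IsIso.of_isIso_comp_right (Base F S.right) (Base F g.den)

/-- A base-isomorphism `[(α, φ′)]` of `C^birat` (for `C^birat → F_{0_D}`) has `Base φ′` invertible.
[cite: MochizukiFrdI2008, Prop. 4.4 (iv) p.84] -/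
theorem isBaseIso_num_of_isBaseIso_homMk {X Y : Birat F hF hsq} (f : BiratFrac F X.out Y.out)
    (h : (biratOps hF hsq).IsBaseIso (Birat.homMk f)) : IsBaseIso F f.num := by
  haveI : IsIso (Base F f.den) := f.den_mem.2.2
  haveI h' : IsIso (inv (Base F f.den) ≫ Base F f.num) := h
  exact IsIso.of_isIso_comp_left (inv (Base F f.den)) (Base F f.num)

/-- **P44iv-L01 + L03** (FrdI p. 85 l. 1–8): `φ` co-angular in `C` ⇒ `φ^birat` co-angular in `C^birat`.
Given a factorisation `φ^birat = γ ≫ β ≫ α` in `C^birat` with `β` an [isometric] pre-step, `α` linear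
and `α` or `γ` a base-isomorphism, write `γ = [(a₁, c₁)]`, `β = [(a₂, b₂)]`, `α = [(a₃, d₃)]` and
compose with two squares (Prop. 1.11 (vii)): `φ^birat = [(a, c ≫ b ≫ d₃)]` where `b` (the right leg of
the square over `b₂`) is a pre-step of `C` and `b ≫ a₃ = (co-angular pre-step) ≫ b₂` ("arises from a
factorization `A′ → C′ → D′ → B` in `C`"); comparing with `φ^birat = [(id, φ)]` gives co-angular
pre-steps `ε`, `ε′` with `ε′ ≫ φ = (ε ≫ c) ≫ b ≫ d₃`, a co-angular composite (Def. 1.3 (iii)(a)); so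
`b` is a co-angular pre-step (P44iv-L02), `b^birat` and hence `b₂^birat` and `β` are isomorphisms.
[cite: MochizukiFrdI2008, Prop. 4.4 (iv) p.85] -/
theorem isCoAngular_toBirat_map {A B : C} {φ : A ⟶ B} (hφ : IsCoAngular F φ) :
    (biratOps hF hsq).IsCoAngular ((toBirat F hF hsq).map φ) := by
  intro X Y γ β α hfac hα hβ hbi
  obtain ⟨g1, rfl⟩ := Birat.homMk_surjective γ
  obtain ⟨g2, rfl⟩ := Birat.homMk_surjective β
  obtain ⟨g3, rfl⟩ := Birat.homMk_surjective α
  -- the two composition squares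
  obtain ⟨S23⟩ := BiratFrac.nonempty_square hsq g2 g3
  obtain ⟨S1⟩ := BiratFrac.nonempty_square hsq g1 (BiratFrac.compWith hF g2 g3 S23)
  rw [Birat.homMk_comp_homMk_eq g2 g3 S23, Birat.homMk_comp_homMk_eq g1 _ S1, toBirat_map] at hfac
  obtain ⟨E, ε, ε', hε, hε', -, hnum⟩ := Birat.homMk_eq_homMk_iff.mp hfac
  -- `hnum : ε ≫ (S1.right ≫ S23.right ≫ g3.num) = ε' ≫ φ`
  have hb2 : IsPreStep F g2.num := isPreStep_num_of_isPreStep_homMk g2 hβ.1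
  have hb : IsPreStep F S23.right := isPreStep_right_of_square S23 hb2
  have hd : IsLinear F g3.num := hα
  have hbase : IsBaseIso F g3.num ∨ IsBaseIso F (ε ≫ S1.right) := by
    refine hbi.imp (fun h3 => isBaseIso_num_of_isBaseIso_homMk g3 h3) fun h1 => ?_
    have hr : IsBaseIso F S1.right := isBaseIso_right_of_square S1 (isBaseIso_num_of_isBaseIso_homMk g1 h1)
    change IsIso (Base F (ε ≫ S1.right))
    rw [base_comp]
    exact @IsIso.comp_isIso _ _ _ _ _ (Base F ε) (Base F S1.right) hε.2.2 hr
  have hco : IsCoAngular F ((ε ≫ S1.right) ≫ S23.right ≫ g3.num) := by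
    have e : (ε ≫ S1.right) ≫ S23.right ≫ g3.num = ε' ≫ φ := by
      rw [Category.assoc]
      exact hnum
    rw [e]
    exact hF.iii_a ε' φ hε'.1 hφ
  have hS : IsCoAngularPreStep F S23.right := IsPreStep.isCoAngularPreStep_of_factor hF hb hd hbase hco
  -- `b^birat` iso ⇒ `b₂^birat` iso ⇒ `β` iso
  haveI := isIso_toBirat_map (hF := hF) (hsq := hsq) S23.right hS
  haveI := isIso_toBirat_map (hF := hF) (hsq := hsq) S23.left S23.left_mem
  haveI := isIso_toBirat_map (hF := hF) (hsq := hsq) g3.den g3.den_mem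
  haveI := isIso_toBirat_map (hF := hF) (hsq := hsq) g2.den g2.den_mem
  have hw : (toBirat F hF hsq).map S23.left ≫ (toBirat F hF hsq).map g2.num =
      (toBirat F hF hsq).map S23.right ≫ (toBirat F hF hsq).map g3.den := by
    rw [← Functor.map_comp, ← Functor.map_comp, S23.w]
  haveI : IsIso ((toBirat F hF hsq).map S23.left ≫ (toBirat F hF hsq).map g2.num) := by
    rw [hw]; infer_instance
  haveI : IsIso ((toBirat F hF hsq).map g2.num) :=
    IsIso.of_isIso_comp_left ((toBirat F hF hsq).map S23.left) ((toBirat F hF hsq).map g2.num)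
  haveI : IsIso ((toBirat F hF hsq).map g2.den ≫
      (Birat.homMk g2 : (toBirat F hF hsq).obj X.out ⟶ (toBirat F hF hsq).obj Y.out)) := by
    rw [toBirat_map_den_comp_homMk hF hsq g2]; infer_instance
  exact IsIso.of_isIso_comp_left ((toBirat F hF hsq).map g2.den)
    (Birat.homMk g2 : (toBirat F hF hsq).obj X.out ⟶ (toBirat F hF hsq).obj Y.out)


end Birat

/-! ### The nine clauses of (iv), image direction, for EVERY Frobenioid -/

section Prop44iv

variable {hF : IsFrobenioid F} {hsq : HasBiratSquares F}

/-- (iv) co-angular ↦ co-angular (P44iv-L03). [cite: MochizukiFrdI2008, Prop. 4.4 (iv) p.83] -/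
theorem toBirat_preservesMor_isCoAngular :
    PreFrobenioidData.PreservesMor (toBirat F hF hsq) (PreFrobenioidData.ofFunctor Φ F).IsCoAngular
      (biratOps hF hsq).IsCoAngular :=
  fun _ _ φ hφ => Birat.isCoAngular_toBirat_map ((PreFrobenioidData.ofFunctor_isCoAngular F φ).mp hφ)

/-- (iv) co-angular pre-step ↦ isomorphism (abc-iut-L6-t8's `Birat.isIso_toBirat_map`).
[cite: MochizukiFrdI2008, Prop. 4.4 (iv) p.83] -/
theorem toBirat_isIso_of_isCoAngularPreStep {A B : C} (φ : A ⟶ B)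
    (hφ : (PreFrobenioidData.ofFunctor Φ F).IsCoAngularPreStep φ) : IsIso ((toBirat F hF hsq).map φ) :=
  Birat.isIso_toBirat_map (hF := hF) (hsq := hsq) φ
    ⟨(PreFrobenioidData.ofFunctor_isCoAngular F φ).mp hφ.1, hφ.2⟩

/-- (iv) base-isomorphism ↦ base-isomorphism. [cite: MochizukiFrdI2008, Prop. 4.4 (iv) p.83] -/
theorem toBirat_preservesMor_isBaseIso :
    PreFrobenioidData.PreservesMor (toBirat F hF hsq) (PreFrobenioidData.ofFunctor Φ F).IsBaseIso
      (biratOps hF hsq).IsBaseIso := by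
  intro A B φ hφ
  change IsIso ((biratOps hF hsq).base.map ((toBirat F hF hsq).map φ))
  rw [biratOps_base_map_toBirat]
  exact hφ

/-- (iv) co-angular base-isomorphism ↦ Frobenius type (= co-angular, isometric [`Div = 0` in `0_D`],
base-isomorphism). [cite: MochizukiFrdI2008, Prop. 4.4 (iv) p.83] -/
theorem toBirat_preservesMor_isFrobeniusType :
    PreFrobenioidData.PreservesMor (toBirat F hF hsq)
      (fun _ _ φ => (PreFrobenioidData.ofFunctor Φ F).IsCoAngular φ ∧ (PreFrobenioidData.ofFunctor Φ F).IsBaseIso φ)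
      (biratOps hF hsq).IsFrobeniusType :=
  fun _ _ φ hφ => ⟨⟨toBirat_preservesMor_isCoAngular φ hφ.1, biratOps_mon_eq_one hF hsq _ _⟩,
    toBirat_preservesMor_isBaseIso φ hφ.2⟩

/-- (iv) co-angular linear ↦ pull-back morphism (abc-iut-L6-t8's
`Birat.isPullbackMorphism_toBirat_map_of_isCoAngular`; `C^birat → F_{0_D}` and `C^birat → F_{Φ^gp}` have
the same base maps). [cite: MochizukiFrdI2008, Prop. 4.4 (iv) p.83] -/
theorem toBirat_preservesMor_isPullbackMorphism :
    PreFrobenioidData.PreservesMor (toBirat F hF hsq)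
      (fun _ _ φ => (PreFrobenioidData.ofFunctor Φ F).IsCoAngular φ ∧ (PreFrobenioidData.ofFunctor Φ F).IsLinear φ)
      (biratOps hF hsq).IsPullbackMorphism := by
  intro A B φ hφ
  have h := Birat.isPullbackMorphism_toBirat_map_of_isCoAngular (hF := hF) (hsq := hsq)
    ((PreFrobenioidData.ofFunctor_isCoAngular F φ).mp hφ.1) hφ.2
  exact (PreFrobenioidData.ofFunctor_isPullbackMorphism (Birat.toElemZero hF hsq) _).mpr h

/-- (iv) Frobenius degrees are preserved. [cite: MochizukiFrdI2008, Prop. 4.4 (iv) p.83] -/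
theorem toBirat_preservesMor_hasDegree (d : ℕ+) :
    PreFrobenioidData.PreservesMor (toBirat F hF hsq) ((PreFrobenioidData.ofFunctor Φ F).HasDegree d)
      ((biratOps hF hsq).HasDegree d) := by
  intro A B φ hφ
  change (biratOps hF hsq).degFr ((toBirat F hF hsq).map φ) = d
  rw [biratOps_degFr_toBirat]
  exact hφ

/-- (iv) every morphism ↦ isometry ("cf. the monoid structure of the monoid `0_D`!", p. 84 l. 45).
[cite: MochizukiFrdI2008, Prop. 4.4 (iv) p.83] -/
theorem toBirat_preservesMor_isIsometry :
    PreFrobenioidData.PreservesMor (toBirat F hF hsq) ⊤ (biratOps hF hsq).IsIsometry :=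
  fun _ _ _ _ => biratOps_mon_eq_one hF hsq _ _

/-- (iv) pre-step ↦ pre-step. [cite: MochizukiFrdI2008, Prop. 4.4 (iv) p.83] -/
theorem toBirat_preservesMor_isPreStep :
    PreFrobenioidData.PreservesMor (toBirat F hF hsq) (PreFrobenioidData.ofFunctor Φ F).IsPreStep
      (biratOps hF hsq).IsPreStep := by
  intro A B φ hφ
  refine ⟨?_, toBirat_preservesMor_isBaseIso φ hφ.2⟩
  change (biratOps hF hsq).degFr ((toBirat F hF hsq).map φ) = 1
  rw [biratOps_degFr_toBirat]
  exact hφ.1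

/-- (iv) isotropic ↦ isotropic (P44iv-L08). [cite: MochizukiFrdI2008, Prop. 4.4 (iv) p.83] -/
theorem toBirat_preservesObj_isIsotropic :
    PreFrobenioidData.PreservesObj (toBirat F hF hsq) (PreFrobenioidData.ofFunctor Φ F).IsIsotropic
      (biratOps hF hsq).IsIsotropic :=
  fun A hA => Birat.isIsotropic_toBirat_obj ((PreFrobenioidData.ofFunctor_isIsotropic F A).mp hA)

/-- **[FrdI] Prop. 4.4 (iv) as typed over the interface (`PreFrobenioidData.Prop44iv`) HOLDS for the
birationalization datum `biratData hF hsq` of EVERY Frobenioid** — no isotropy hypothesis: all nine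
image-direction clauses (co-angular; co-angular pre-step ↦ isomorphism; co-angular base-isomorphism ↦
Frobenius type; co-angular linear ↦ pull-back; degrees; isometries; pre-steps; base-isomorphisms;
isotropic objects). [cite: MochizukiFrdI2008, Prop. 4.4 (iv) p.83] -/
theorem prop44iv_biratData_general :
    Literature.AlgebraicGeometry.Frobenioids.PreFrobenioidData.Prop44iv (biratData hF hsq) :=
  ⟨toBirat_preservesMor_isCoAngular, fun _ _ φ hφ => toBirat_isIso_of_isCoAngularPreStep φ hφ,
    toBirat_preservesMor_isFrobeniusType, toBirat_preservesMor_isPullbackMorphism,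
    toBirat_preservesMor_hasDegree, toBirat_preservesMor_isIsometry, toBirat_preservesMor_isPreStep,
    toBirat_preservesMor_isBaseIso, toBirat_preservesObj_isIsotropic⟩

/-- **[FrdI] Prop. 4.4 (iv) HOLDS for EVERY Frobenioid** (abc-iut-L1-t3's `Prop44iv` at the
birationalization datum `biratData hF (hasBiratSquares_of_isFrobenioid hF)`, the composition squares of
Prop. 1.11 (vii) being discharged by abc-iut-L6-t6's `hasBiratSquares_of_isFrobenioid`).
[cite: MochizukiFrdI2008, Prop. 4.4 (iv) p.83] -/
theorem prop44iv_holds_of_isFrobenioid (hF : IsFrobenioid F) :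
    Literature.AlgebraicGeometry.Frobenioids.PreFrobenioidData.Prop44iv
      (biratData hF (hasBiratSquares_of_isFrobenioid hF)) :=
  prop44iv_biratData_general

end Prop44iv

end PreFrobenioid

end Literature.AlgebraicGeometry.Frobenioids
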